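import Mathlib
import HarnessLib
import Summits.HubbardSuperconductivity.HubbardSuperconductivity.Theorems.KLProgrammeKLRegimeSplitEdgeFactsSliceLines

/-!
# Route `KLProgramme` — ENGINE child gen 8 (stmt-HubbardSuperconductivity-20437 `KLRegimeEngineV17F2`), skeleton v2 class #5 rev 3 «RELATIVE family» (plan g20 (R54f)/(R54g),
# working text-elect; door k3c1-p1 g10): the RELATIVE model weights of two members — bilinearity and their masses in units of the SOFT SUM of the difference symbol
# (cell gate-hubbard-kl, seat hubbard-kl-p1 g12 = EdgeFacts lane / class-#5 text owner)

WHY.  (R54f): the class-#5 straddle is carried RELATIVELY — member `ψ₁` against member `ψ₂` at the same scale, with the resolvent `F_a`, `a = t_n[ψ₁] − t_n[ψ₂]`, and a defect allowance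
`transferBarAt n · mass_n(ψ₁ − ψ₂)`, `mass_n(D) ∝ (Λ_n βL²)⁻¹·Σ_k |D(k)|·‖ĝ_K(k)‖` (k3c1-p1's `klSoftMass`; `mass_{n−1} = mass_n/4` is the contraction that defeats the accumulation of
CLASS5-COMPOSE-BUDGET / CLASS5-DEFECT-BUDGET).  The relative door integrates the relative rung `ȧ = ḃ¹ − ḃ²` and needs, BY NAME, that every relative weight is the weight of the
DIFFERENCE symbol and that its mass is a fixed multiple of that soft sum — this file (no definition; the soft sum is written out, so any normalisation of `klSoftMass` reads it):
* §1 BILINEARITY: `klTransferWeight_add/_sub/_neg` (`t_n[ψ₁] − t_n[ψ₂] = t_n[ψ₁ − ψ₂]`), `klSliceWeightSmeared_sub` (`w₁[ψ₁] − w₁[ψ₂] = B(s, D) + B(D, s)`, `D = ψ₁ − ψ₂`, `s = s_{n+1}`);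
* §2 MASSES of a weight with an ARBITRARY real symbol `D` (no sign / admissibility needed): **`sum_abs_klTransferWeight_le_softSum`** (`Σ_p |t_n[D](Qm,p)| ≤ (βL²)⁻¹·(4/Λ_n)·Σ_k |D(k)|‖ĝ_K(k)‖`),
  **`sum_abs_klSliceWeightSmeared_sub_le_softSum`** (`Σ_p |w₁[ψ₁] − w₁[ψ₂]| ≤ (βL²)⁻¹·(4/Λ_{n+1})·Σ_k |D(k)|‖ĝ_K(k)‖`) — i.e. `4·mass_n(D)` and `16·mass_n(D)` in units `(Λ_n βL²)⁻¹Σ|D|‖ĝ‖`;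
* §3 the soft sums that occur: a symbol soft at a DEEPER scale `m ≥ n` has `Σ_k |D|‖ĝ‖ ≤ 15367·Λ_m·βL² = 15367·4^{−(m−n)}·Λ_n·βL²` (`sum_softSymbol_mul_norm_propCT_le_deep`), in particular the
  slice symbols `s_{m+1}` (`sum_softSymbolCompl_succ_mul_norm_propCT_le_deep`): the difference of CONSECUTIVE complementary members is gained by `4^{−(m−n)}` at scale `n`.
Elementary; nothing about the effective action is asserted; nothing asserts superconductivity.  0 kit.
-/

noncomputable section

namespace Summit.HubbardSuperconductivity.HubbardSuperconductivity.Theorems.KLRegimeSplit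

set_option linter.dupNamespace false -- summit = problem name (single-conjunct summit), D-0017

open Real Finset Complex Literature.MathematicalPhysics.QuantumLattice Literature.Probability.LatticeModels
open Summit.HubbardSuperconductivity.HubbardSuperconductivity.Theorems.KLProgrammeLegKernels
open Summit.HubbardSuperconductivity.HubbardSuperconductivity.Theorems.TwoPointAssembly

/-! ## §1 Bilinearity: relative weights are weights of the difference symbol -/

section Bilinear

variable {L M : ℕ} (β μ : ℝ) (K : TrigPolyC4v)

/-- The pinned weight is additive in the symbol. -/
theorem klTransferWeight_add (n : ℕ) (ψ₁ ψ₂ : FreqMomentum L M → ℝ) (Qm p : TorusSite 2 L) :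
    klTransferWeight L M β μ K n (ψ₁ + ψ₂) Qm p = klTransferWeight L M β μ K n ψ₁ Qm p + klTransferWeight L M β μ K n ψ₂ Qm p := by
  simp only [klTransferWeight_eq_neg_bubbleMass, klBubbleMass_add_left, klBubbleMass_add_right]
  ring

/-- The pinned weight of the negated symbol. -/
theorem klTransferWeight_neg (n : ℕ) (ψ : FreqMomentum L M → ℝ) (Qm p : TorusSite 2 L) :
    klTransferWeight L M β μ K n (-ψ) Qm p = -klTransferWeight L M β μ K n ψ Qm p := by
  have h := klTransferWeight_add β μ K n ψ (-ψ) Qm p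
  have h0 : klTransferWeight L M β μ K n (ψ + -ψ) Qm p = 0 := by simp [klTransferWeight]
  rw [h0] at h
  linarith

/-- **The RELATIVE pinned weight is the pinned weight of the difference symbol**: `t_n[ψ₁] − t_n[ψ₂] = t_n[ψ₁ − ψ₂]`. -/
theorem klTransferWeight_sub (n : ℕ) (ψ₁ ψ₂ : FreqMomentum L M → ℝ) (Qm p : TorusSite 2 L) :
    klTransferWeight L M β μ K n ψ₁ Qm p - klTransferWeight L M β μ K n ψ₂ Qm p = klTransferWeight L M β μ K n (ψ₁ - ψ₂) Qm p := by
  rw [sub_eq_add_neg ψ₁, klTransferWeight_add, klTransferWeight_neg]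
  ring

/-- **The RELATIVE smeared slice weight**: `w₁^{(ψ₁)}_{n+1} − w₁^{(ψ₂)}_{n+1} = B(s_{n+1}, ψ₁ − ψ₂) + B(ψ₁ − ψ₂, s_{n+1})` (the `B(s,s)` rung is common and cancels). -/
theorem klSliceWeightSmeared_sub (n : ℕ) (ψ₁ ψ₂ : FreqMomentum L M → ℝ) (Qm p : TorusSite 2 L) :
    klSliceWeightSmeared L M β μ K (n + 1) ψ₁ Qm p - klSliceWeightSmeared L M β μ K (n + 1) ψ₂ Qm p =
      klBubbleMass L M β μ K (softSymbolCompl L M β μ K n (n + 1)) (ψ₁ - ψ₂) Qm p +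
        klBubbleMass L M β μ K (ψ₁ - ψ₂) (softSymbolCompl L M β μ K n (n + 1)) Qm p := by
  have hψ : ψ₁ = (ψ₁ - ψ₂) + ψ₂ := by abel
  rw [klSliceWeightSmeared_succ_eq_bubbleMass, klSliceWeightSmeared_succ_eq_bubbleMass]
  conv_lhs => rw [hψ]
  rw [show (ψ₁ - ψ₂ + ψ₂) + softSymbolCompl L M β μ K n (n + 1) = (ψ₁ - ψ₂) + (ψ₂ + softSymbolCompl L M β μ K n (n + 1)) by abel,
    klBubbleMass_add_right, klBubbleMass_add_left]
  ring

/-- **The RELATIVE conservation identity** (identity 1 for a pair of members; the PLAIN slice weight cancels): for every pair of symbols `ψ₁, ψ₂` and `s = s_{n+1}`,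
`t_{n+1}[ψ₁] − t_{n+1}[ψ₂] = (t_n[ψ₁ + s] − t_n[ψ₂ + s]) − (w₁^{(ψ₁)}_{n+1} − w₁^{(ψ₂)}_{n+1})` — the relative weight of the pair at the new scale is the relative weight of the
history pair `(ψ₁ + s | ψ₂ + s)` (SAME difference symbol) minus the relative tower rung; no plain step enters (`klTransferWeight_succ` twice). -/
theorem klTransferWeight_sub_succ (n : ℕ) (ψ₁ ψ₂ : FreqMomentum L M → ℝ) (Qm p : TorusSite 2 L) :
    klTransferWeight L M β μ K (n + 1) ψ₁ Qm p - klTransferWeight L M β μ K (n + 1) ψ₂ Qm p =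
      (klTransferWeight L M β μ K n (ψ₁ + softSymbolCompl L M β μ K n (n + 1)) Qm p -
          klTransferWeight L M β μ K n (ψ₂ + softSymbolCompl L M β μ K n (n + 1)) Qm p) -
        (klSliceWeightSmeared L M β μ K (n + 1) ψ₁ Qm p - klSliceWeightSmeared L M β μ K (n + 1) ψ₂ Qm p) := by
  rw [klTransferWeight_succ β μ K n ψ₁, klTransferWeight_succ β μ K n ψ₂]
  ring

/-- The history pair has the SAME difference symbol: `(ψ₁ + s) − (ψ₂ + s) = ψ₁ − ψ₂`, so its relative weight is again `t_n[ψ₁ − ψ₂]`. -/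
theorem klTransferWeight_sub_add_compl (n : ℕ) (ψ₁ ψ₂ : FreqMomentum L M → ℝ) (Qm p : TorusSite 2 L) :
    klTransferWeight L M β μ K n (ψ₁ + softSymbolCompl L M β μ K n (n + 1)) Qm p -
        klTransferWeight L M β μ K n (ψ₂ + softSymbolCompl L M β μ K n (n + 1)) Qm p =
      klTransferWeight L M β μ K n (ψ₁ - ψ₂) Qm p := by
  rw [klTransferWeight_sub, add_sub_add_right_eq_sub]

end Bilinear

/-! ## §2 Masses of weights with an arbitrary real symbol, in units of its soft sum -/

section Mass

variable {L M : ℕ} [NeZero L] (β μ : ℝ) (K : TrigPolyC4v)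

/-- **Mass of the pinned weight of ANY real symbol `D`** (e.g. a difference of members): `Σ_p |t_n[D](Qm,p)| ≤ (βL²)⁻¹·(4/Λ_n)·Σ_k |D(k)|·‖ĝ_K(k)‖` — the two rungs `w_{Λ_n}⊗D`,
`D⊗w_{Λ_n}` with the hard line `≤ 2/Λ_n`. -/
theorem sum_abs_klTransferWeight_le_softSum (hβ : 0 < β) (n : ℕ) (D : FreqMomentum L M → ℝ) (Qm : TorusSite 2 L) :
    ∑ p, |klTransferWeight L M β μ K n D Qm p| ≤
      (β * (L : ℝ) ^ 2)⁻¹ * (4 / klScale klE0 n) * ∑ k : FreqMomentum L M, |D k| * ‖propCT L M β μ K k‖ := by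
  have hΛ : 0 < klScale klE0 n := klth_klScale_pos n
  have hA := abs_hubbardCutoffWeightCT_mul_norm_propCT_le (L := L) (M := M) β μ K hΛ
  have h1 := sum_abs_klBubbleMass_le_of_left β μ K hβ D hA Qm
  have h2 := sum_abs_klBubbleMass_le_of_right β μ K hβ D hA Qm
  calc ∑ p, |klTransferWeight L M β μ K n D Qm p|
      ≤ ∑ p, (|klBubbleMass L M β μ K (hubbardCutoffWeightCT L M β μ K (klScale klE0 n)) D Qm p| +
          |klBubbleMass L M β μ K D (hubbardCutoffWeightCT L M β μ K (klScale klE0 n)) Qm p|) :=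
        sum_le_sum fun p _ => by rw [klTransferWeight_eq_neg_bubbleMass, abs_neg]; exact abs_add_le _ _
    _ ≤ (β * (L : ℝ) ^ 2)⁻¹ * (2 / klScale klE0 n) * ∑ k, |D k| * ‖propCT L M β μ K k‖ +
          (β * (L : ℝ) ^ 2)⁻¹ * (2 / klScale klE0 n) * ∑ k, |D k| * ‖propCT L M β μ K k‖ := by
        rw [sum_add_distrib]; exact add_le_add h1 h2
    _ = (β * (L : ℝ) ^ 2)⁻¹ * (4 / klScale klE0 n) * ∑ k, |D k| * ‖propCT L M β μ K k‖ := by ring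

/-- **Mass of the relative smeared slice weight**: `Σ_p |w₁^{(ψ₁)}_{n+1} − w₁^{(ψ₂)}_{n+1}| ≤ (βL²)⁻¹·(4/Λ_{n+1})·Σ_k |(ψ₁−ψ₂)(k)|·‖ĝ_K(k)‖` (the slice symbol is hard at `n+1`:
`|s_{n+1}|‖ĝ‖ ≤ 2/Λ_{n+1}`). -/
theorem sum_abs_klSliceWeightSmeared_sub_le_softSum (hβ : 0 < β) (n : ℕ) (ψ₁ ψ₂ : FreqMomentum L M → ℝ) (Qm : TorusSite 2 L) :
    ∑ p, |klSliceWeightSmeared L M β μ K (n + 1) ψ₁ Qm p - klSliceWeightSmeared L M β μ K (n + 1) ψ₂ Qm p| ≤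
      (β * (L : ℝ) ^ 2)⁻¹ * (4 / klScale klE0 (n + 1)) * ∑ k : FreqMomentum L M, |(ψ₁ - ψ₂) k| * ‖propCT L M β μ K k‖ := by
  have hA := softSymbolCompl_succ_mul_norm_propCT_le (L := L) (M := M) β μ K n
  have h1 := sum_abs_klBubbleMass_le_of_left β μ K hβ (ψ₁ - ψ₂) hA Qm
  have h2 := sum_abs_klBubbleMass_le_of_right β μ K hβ (ψ₁ - ψ₂) hA Qm
  calc ∑ p, |klSliceWeightSmeared L M β μ K (n + 1) ψ₁ Qm p - klSliceWeightSmeared L M β μ K (n + 1) ψ₂ Qm p|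
      ≤ ∑ p, (|klBubbleMass L M β μ K (softSymbolCompl L M β μ K n (n + 1)) (ψ₁ - ψ₂) Qm p| +
          |klBubbleMass L M β μ K (ψ₁ - ψ₂) (softSymbolCompl L M β μ K n (n + 1)) Qm p|) :=
        sum_le_sum fun p _ => by rw [klSliceWeightSmeared_sub]; exact abs_add_le _ _
    _ ≤ (β * (L : ℝ) ^ 2)⁻¹ * (2 / klScale klE0 (n + 1)) * ∑ k, |(ψ₁ - ψ₂) k| * ‖propCT L M β μ K k‖ +
          (β * (L : ℝ) ^ 2)⁻¹ * (2 / klScale klE0 (n + 1)) * ∑ k, |(ψ₁ - ψ₂) k| * ‖propCT L M β μ K k‖ := by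
        rw [sum_add_distrib]; exact add_le_add h1 h2
    _ = (β * (L : ℝ) ^ 2)⁻¹ * (4 / klScale klE0 (n + 1)) * ∑ k, |(ψ₁ - ψ₂) k| * ‖propCT L M β μ K k‖ := by ring

/-- The relative pinned weight's mass, stated for the pair: `Σ_p |t_n[ψ₁] − t_n[ψ₂]| ≤ (βL²)⁻¹·(4/Λ_n)·Σ_k |(ψ₁−ψ₂)(k)|·‖ĝ_K(k)‖`. -/
theorem sum_abs_klTransferWeight_sub_le_softSum (hβ : 0 < β) (n : ℕ) (ψ₁ ψ₂ : FreqMomentum L M → ℝ) (Qm : TorusSite 2 L) :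
    ∑ p, |klTransferWeight L M β μ K n ψ₁ Qm p - klTransferWeight L M β μ K n ψ₂ Qm p| ≤
      (β * (L : ℝ) ^ 2)⁻¹ * (4 / klScale klE0 n) * ∑ k : FreqMomentum L M, |(ψ₁ - ψ₂) k| * ‖propCT L M β μ K k‖ := by
  simp_rw [klTransferWeight_sub]
  exact sum_abs_klTransferWeight_le_softSum β μ K hβ n (ψ₁ - ψ₂) Qm

end Mass

/-! ## §3 The soft sums that occur: symbols soft at a deeper scale are gained at the current one -/

section Deep

variable {L M : ℕ} [NeZero L] (β μ : ℝ) (K : TrigPolyC4v) {R : RenConsts} {U : ℝ} {N : ℕ}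

/-- `Λ_m = 4^{−(m−n)}·Λ_n` for `n ≤ m`. -/
theorem klScale_eq_pow_mul_of_le {n m : ℕ} (hnm : n ≤ m) : klScale klE0 m = ((4 : ℝ) ^ (m - n))⁻¹ * klScale klE0 n := by
  unfold klScale
  obtain ⟨d, rfl⟩ := Nat.exists_eq_add_of_le hnm
  rw [Nat.add_sub_cancel_left, pow_add, mul_inv]
  ring

/-- **A symbol soft at the DEEPER scale `m ≥ n` is gained at scale `n`**: `0 ≤ φ ≤ 1 − w_{Λ_m}` ⇒ `Σ_k |φ|‖ĝ‖ ≤ 15367·4^{−(m−n)}·Λ_n·βL²` on an admissible frame,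
`klBetaMin ≤ β ≤ L` (the soft sum at scale `m`, rewritten in units of `Λ_n`). -/
theorem sum_softSymbol_mul_norm_propCT_le_deep (hK : FrameOK R U N μ K) (hβ : klBetaMin ≤ β) (hβL : β ≤ L) {n m : ℕ} (hnm : n ≤ m)
    {φ : FreqMomentum L M → ℝ} (hφ : ∀ k, 0 ≤ φ k ∧ φ k ≤ 1 - hubbardCutoffWeightCT L M β μ K (klScale klE0 m) k) :
    ∑ k : FreqMomentum L M, |φ k| * ‖propCT L M β μ K k‖ ≤ 15367 * ((4 : ℝ) ^ (m - n))⁻¹ * klScale klE0 n * β * (L : ℝ) ^ 2 := by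
  have h := sum_softSymbol_mul_norm_propCT_le_of_frameOK β μ K hK hβ hβL m hφ
  rw [klScale_eq_pow_mul_of_le hnm] at h
  linarith

/-- **The slice symbol of a deeper slice**: `Σ_k |s_{m+1}(k)|·‖ĝ_K(k)‖ ≤ 15367·4^{−(m−n)}·Λ_n·βL²` for `n ≤ m` — the difference symbol of the CONSECUTIVE complementary members `m`, `m+1`
carries the gain `4^{−(m−n)}` at scale `n`. -/
theorem sum_softSymbolCompl_succ_mul_norm_propCT_le_deep (hK : FrameOK R U N μ K) (hβ : klBetaMin ≤ β) (hβL : β ≤ L) {n m : ℕ} (hnm : n ≤ m) :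
    ∑ k : FreqMomentum L M, |softSymbolCompl L M β μ K m (m + 1) k| * ‖propCT L M β μ K k‖ ≤
      15367 * ((4 : ℝ) ^ (m - n))⁻¹ * klScale klE0 n * β * (L : ℝ) ^ 2 :=
  sum_softSymbol_mul_norm_propCT_le_deep β μ K hK hβ hβL hnm (isSoftSymbol_compl (L := L) (M := M) β μ K (Nat.le_succ m)).1

/-- **Hence the relative pinned weight of consecutive complementary members is gained**: with `D = s_{m+1}` (`n ≤ m`),
`Σ_p |t_n[ψ + s_{m+1}] − t_n[ψ]| ≤ 4·15367·4^{−(m−n)}` for every symbol `ψ`, every `Qm` (`klBetaMin ≤ β ≤ L`, admissible frame). -/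
theorem sum_abs_klTransferWeight_sub_compl_succ_le (hK : FrameOK R U N μ K) (hβ : klBetaMin ≤ β) (hβL : β ≤ L) {n m : ℕ} (hnm : n ≤ m)
    (ψ : FreqMomentum L M → ℝ) (Qm : TorusSite 2 L) :
    ∑ p, |klTransferWeight L M β μ K n (ψ + softSymbolCompl L M β μ K m (m + 1)) Qm p - klTransferWeight L M β μ K n ψ Qm p| ≤
      4 * 15367 * ((4 : ℝ) ^ (m - n))⁻¹ := by
  have hβ0 : 0 < β := pos_of_klBetaMin_le hβ
  have hL : (0 : ℝ) < L := lt_of_lt_of_le hβ0 hβL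
  have hΛ : 0 < klScale klE0 n := klth_klScale_pos n
  have h1 := sum_abs_klTransferWeight_sub_le_softSum β μ K hβ0 n (ψ + softSymbolCompl L M β μ K m (m + 1)) ψ Qm
  have h2 := sum_softSymbolCompl_succ_mul_norm_propCT_le_deep (M := M) β μ K hK hβ hβL hnm
  have hD : (ψ + softSymbolCompl L M β μ K m (m + 1)) - ψ = softSymbolCompl L M β μ K m (m + 1) := by abel
  rw [hD] at h1
  have hc : 0 ≤ (β * (L : ℝ) ^ 2)⁻¹ * (4 / klScale klE0 n) := by positivity
  refine h1.trans ((mul_le_mul_of_nonneg_left h2 hc).trans (le_of_eq ?_))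
  field_simp

end Deep

end Summit.HubbardSuperconductivity.HubbardSuperconductivity.Theorems.KLRegimeSplit

end
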